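import Mathlib
import Summits.Ventures.PercRepro2.RootBridgeStates

/-!
# The cut vertex at a root, I: the kernel on the states (blind cell PercRepro2, p3 g0,
2026-08-25; `proofs/P3-BRIDGE.md` §8)

When `a₁` is a cut vertex separating `{o, b}` from `{a₂, a₃}`, every copy of the support has the
bridge state `brSt true s Lo Lb` of `RootBridgeStates.lean` — the root-bridge state with the bridge
bit constantly `true` (the pattern `(true, true, true)`, inadmissible for a typed bridge) — with
`s : HState` the set partition of `{a₂, a₁, a₃}` induced by `a₂`'s side.  The kernel is again the
four-monomial expansion in the `l`-bits (`KB_cutSt`), the symmetrised coefficient of `L_b L_o` is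
nonnegative — it is `2·(1[B,D,E] + 1[B,B,E] + 1[B,E,E])` on the multisets of `h`-states
(`sym_H1_ttt_nonneg`) — and the symmetrised sum of the four coefficients vanishes
(`sym_sum_ttt_eq_zero`).  Own work; standard axioms.
-/

namespace Summit.Ventures.PercRepro2

namespace CovForm

namespace RootBridge

open OneTyped

/-- The kernel on cut-root states (bridge bit `true` in every copy) is the four-monomial
expansion (`decide`, 8,000 cases). -/
theorem KB_cutSt (sx : HState) (Lox Lbx : Bool) (sy : HState) (Loy Lby : Bool) (sw : HState)
    (Low Lbw : Bool) :
    KB (brSt true sx Lox Lbx) (brSt true sy Loy Lby) (brSt true sw Low Lbw) =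
      expansion true sx Lox true sy Loy Lby true sw Low Lbw := by
  revert sx Lox Lbx sy Loy Lby sw Low Lbw
  decide +kernel

/-- **The symmetrised `L_b L_o`-coefficient is nonnegative** on cut-root states. -/
theorem sym_H1_ttt_nonneg (sx sy sw : HState) :
    0 ≤ symH H1 true sx true sy true sw := by
  revert sx sy sw
  decide +kernel

/-- The four coefficients sum to zero after symmetrisation on cut-root states. -/
theorem sym_sum_ttt_eq_zero (sx sy sw : HState) :
    symH H1 true sx true sy true sw + symH H2 true sx true sy true sw +
      symH H3 true sx true sy true sw + symH H4 true sx true sy true sw = 0 := by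
  revert sx sy sw
  decide +kernel

end RootBridge

end CovForm

end Summit.Ventures.PercRepro2
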